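import Summits.Ventures.HodgeRepro.BallInvariance

/-!
# Congruence subgroups of `U(2,1)` and the finite-index clause of Lemma W (seat p5)

Blind re-derivation cell `pub-hodge-repro`, seat `p5`.  Built on `BallInvariance.lean` (the conjugate
subgroup `conjSub g Γ = g⁻¹ Γ g`, the A4 invariance bookkeeping).  Mathlib otherwise.

ROUTE.md Appendix A4 reads the wedge `η ∧ g^*ω` as a form on the finite cover `Γ″\𝔹²`,
`Γ″ = Γ′ ∩ g⁻¹ Γ′ g`, "congruence, finite index".  This file proves the FINITE-INDEX clause for the
arithmetic subgroups of the sealed `U(2,1)`: for a subring `φ : R →+* ℂ` (injective) with finite quotients,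

* `arith φ = U(2,1)(R)` — the elements of `U(2,1)` whose matrix and inverse matrix have entries in `φ(R)`;
* `congr φ hφ K = Γ(K)` — the principal congruence subgroup of level `K ∈ R`: `mat g ≡ 1 (mod K)`,
  realised as the kernel of the reduction `U(2,1)(R) → GL₃(R/K)` (`red`);
* `isFiniteRelIndex_congr` — `Γ(K)` has finite index in `U(2,1)(R)` when `R/K` is finite;
* `congr_le_conjSub` — **Hecke conjugation**: if `N·g` and `N·g⁻¹` are integral then
  `g Γ(N²M) g⁻¹ ≤ Γ(M)`, i.e. `Γ(N²M) ≤ g⁻¹ Γ(M) g`;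
* `isFiniteRelIndex_inf_conjSub` — **the finite-index clause of A4**: for `Γ(M) ≤ Γ′ ≤ U(2,1)(R)` and
  such a `g`, the subgroup `Γ′ ⊓ g⁻¹ Γ′ g` has finite index in `Γ′`;
* `isInvariantTop_wedgeForm_pull_finiteIndex` — combined with `BallInvariance`: for `Γ′`-invariant
  fields `F, G`, the `(2,0)`-form `(g^*F) ∧ G` is invariant under a FINITE-INDEX subgroup of `Γ′`;
* `finite_int_quotient`, the instantiation `R = ℤ` (`φ = Int.cast`) — the lattice `U(2,1)(ℤ)`.

Nothing here says anything about the status of the Hodge conjecture for CM abelian varieties.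
-/

set_option autoImplicit false

noncomputable section

universe u

namespace Summit.Ventures.HodgeRepro

namespace BallCong

open Matrix hiding J
open BallModel BallCore BallInv

variable {R : Type u} [CommRing R] (φ : R →+* ℂ)

/-! ### Integral matrices and the arithmetic subgroup `U(2,1)(R)` -/

/-- The ring map `M₃(R) → M₃(ℂ)` induced by `φ`. -/
abbrev Mφ : Matrix (Fin 3) (Fin 3) R →+* Matrix (Fin 3) (Fin 3) ℂ := φ.mapMatrix

/-- The group map `GL₃(R) → GL₃(ℂ)` induced by `φ`. -/
def ι : (Matrix (Fin 3) (Fin 3) R)ˣ →* GL3 := Units.map (Mφ φ).toMonoidHom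

/-- The matrix of `ι u` is the image of the matrix of `u`. -/
theorem coe_ι (u : (Matrix (Fin 3) (Fin 3) R)ˣ) :
    ((ι φ u : GL3) : Matrix (Fin 3) (Fin 3) ℂ) = Mφ φ (u : Matrix (Fin 3) (Fin 3) R) := rfl

/-- `ι` is injective when `φ` is. -/
theorem ι_injective (hφ : Function.Injective φ) : Function.Injective (ι φ) := by
  intro u v h
  apply Units.ext
  have h1 : Mφ φ (u : Matrix (Fin 3) (Fin 3) R) = Mφ φ (v : Matrix (Fin 3) (Fin 3) R) := by
    rw [← coe_ι, ← coe_ι, h]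
  exact Matrix.map_injective hφ h1

/-- The arithmetic subgroup `U(2,1)(R) ≤ U(2,1)`: the elements of `U(2,1)` that are images of
invertible `R`-matrices (matrix AND inverse matrix with entries in `φ(R)`). -/
def arith : Subgroup U21 := (ι φ).range.comap U21.subtype

/-- `g ∈ U(2,1)(R)` iff `g` is the image of an invertible `R`-matrix. -/
theorem mem_arith {g : U21} : g ∈ arith φ ↔ ∃ u : (Matrix (Fin 3) (Fin 3) R)ˣ, ι φ u = (g : GL3) :=
  Iff.rfl

section lift

variable (hφ : Function.Injective φ)

/-- The invertible `R`-matrix underlying an element of `U(2,1)(R)` (unique, `φ` being injective). -/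
def lift (g : arith φ) : (Matrix (Fin 3) (Fin 3) R)ˣ := Classical.choose ((mem_arith φ).mp g.2)

/-- `ι (lift g) = g`. -/
theorem ι_lift (g : arith φ) : ι φ (lift φ g) = ((g : U21) : GL3) :=
  Classical.choose_spec ((mem_arith φ).mp g.2)

include hφ in
/-- `lift` is determined by its image. -/
theorem lift_eq_of_ι_eq {g : arith φ} {u : (Matrix (Fin 3) (Fin 3) R)ˣ} (h : ι φ u = ((g : U21) : GL3)) :
    lift φ g = u :=
  ι_injective φ hφ (by rw [ι_lift, h])

include hφ in
/-- `lift` is multiplicative. -/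
theorem lift_mul (g h : arith φ) : lift φ (g * h) = lift φ g * lift φ h := by
  apply ι_injective φ hφ
  rw [map_mul, ι_lift, ι_lift, ι_lift]
  rfl

include hφ in
/-- `lift 1 = 1`. -/
theorem lift_one : lift φ (1 : arith φ) = 1 := by
  apply ι_injective φ hφ
  rw [map_one, ι_lift]
  rfl

/-- `lift` as a group homomorphism `U(2,1)(R) → GL₃(R)`. -/
def liftHom : arith φ →* (Matrix (Fin 3) (Fin 3) R)ˣ where
  toFun := lift φ
  map_one' := lift_one φ hφ
  map_mul' := lift_mul φ hφ

/-- `liftHom` unfolded. -/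
theorem liftHom_apply (g : arith φ) : liftHom φ hφ g = lift φ g := rfl

/-! ### Reduction modulo `K` and the principal congruence subgroups -/

/-- Reduction modulo `K`: the group homomorphism `U(2,1)(R) → GL₃(R/K)`. -/
def red (K : R) : arith φ →* (Matrix (Fin 3) (Fin 3) (R ⧸ Ideal.span {K}))ˣ :=
  (Units.map (Ideal.Quotient.mk (Ideal.span {K})).mapMatrix.toMonoidHom).comp (liftHom φ hφ)

/-- The matrix of `red K g` is the reduction of the matrix of `lift g`. -/
theorem coe_red (K : R) (g : arith φ) :
    ((red φ hφ K g : (Matrix (Fin 3) (Fin 3) (R ⧸ Ideal.span {K}))ˣ) :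
        Matrix (Fin 3) (Fin 3) (R ⧸ Ideal.span {K})) =
      (lift φ g : Matrix (Fin 3) (Fin 3) R).map (Ideal.Quotient.mk (Ideal.span {K})) := rfl

/-- The principal congruence subgroup `Γ(K)` of level `K`, as a subgroup of `U(2,1)(R)`: the kernel of
the reduction modulo `K`. -/
def congrSub (K : R) : Subgroup (arith φ) := (red φ hφ K).ker

/-- The principal congruence subgroup `Γ(K)` of level `K`, as a subgroup of `U(2,1)`. -/
def congr (K : R) : Subgroup U21 := (congrSub φ hφ K).map (arith φ).subtype

/-- `Γ(K) ≤ U(2,1)(R)`. -/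
theorem congr_le_arith (K : R) : congr φ hφ K ≤ arith φ := Subgroup.map_subtype_le _

/-- `Γ(K)` viewed inside `U(2,1)(R)` is the kernel of the reduction. -/
theorem congr_subgroupOf_arith (K : R) : (congr φ hφ K).subgroupOf (arith φ) = congrSub φ hφ K :=
  Subgroup.comap_map_eq_self_of_injective (arith φ).subtype_injective _

/-- **Finite index.**  When `R/K` is finite, `Γ(K)` has finite index in `U(2,1)(R)`
(it is the kernel of a homomorphism into the finite group `GL₃(R/K)`). -/
theorem isFiniteRelIndex_congr (K : R) [Finite (R ⧸ Ideal.span {K})] :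
    (congr φ hφ K).IsFiniteRelIndex (arith φ) := by
  rw [Subgroup.isFiniteRelIndex_iff_finiteIndex, congr_subgroupOf_arith]
  exact Subgroup.finiteIndex_ker _

/-! ### Integral presentations of the elements of `Γ(K)` -/

/-- `φ` commutes with scalars: `Mφ (K • X) = φ K • Mφ X`. -/
theorem Mφ_smul (K : R) (X : Matrix (Fin 3) (Fin 3) R) : Mφ φ (K • X) = φ K • Mφ φ X := by
  ext i j
  simp [Matrix.map_apply]

/-- An element of `U(2,1)` whose matrix is the image of an invertible `R`-matrix lies in `U(2,1)(R)`. -/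
theorem mem_arith_of {g : U21} (u : (Matrix (Fin 3) (Fin 3) R)ˣ)
    (hu : Mφ φ (u : Matrix (Fin 3) (Fin 3) R) = mat g) : g ∈ arith φ :=
  ⟨u, Units.ext hu⟩

include hφ in
/-- `C * D = 1` in `M₃(R)` as soon as it holds after `φ` (`φ` injective). -/
theorem mul_eq_one_of_Mφ {C D : Matrix (Fin 3) (Fin 3) R} (h : Mφ φ C * Mφ φ D = 1) : C * D = 1 := by
  have h1 : Mφ φ (C * D) = Mφ φ 1 := by rw [map_mul, h, map_one]
  exact Matrix.map_injective hφ h1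

/-- The invertible `R`-matrix with entries `C`, inverse `D`, built from the relations after `φ`. -/
def unitOf (C D : Matrix (Fin 3) (Fin 3) R) (h1 : Mφ φ C * Mφ φ D = 1) (h2 : Mφ φ D * Mφ φ C = 1) :
    (Matrix (Fin 3) (Fin 3) R)ˣ :=
  ⟨C, D, mul_eq_one_of_Mφ φ hφ h1, mul_eq_one_of_Mφ φ hφ h2⟩

/-- The matrix of `unitOf C D` is `C`. -/
theorem coe_unitOf (C D : Matrix (Fin 3) (Fin 3) R) (h1 : Mφ φ C * Mφ φ D = 1)
    (h2 : Mφ φ D * Mφ φ C = 1) : ((unitOf φ hφ C D h1 h2 : (Matrix (Fin 3) (Fin 3) R)ˣ) :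
      Matrix (Fin 3) (Fin 3) R) = C := rfl

/-- `1 + K • C` reduces to `1` modulo `K`. -/
theorem map_one_add_smul (K : R) (C : Matrix (Fin 3) (Fin 3) R) :
    (1 + K • C).map (Ideal.Quotient.mk (Ideal.span {K})) = 1 := by
  ext i j
  simp [Matrix.map_apply, Matrix.one_apply]

/-- A matrix reducing to `1` modulo `K` is `1 + K • C` for some `C`. -/
theorem exists_eq_one_add_smul {K : R} {v : Matrix (Fin 3) (Fin 3) R}
    (hv : v.map (Ideal.Quotient.mk (Ideal.span {K})) = 1) : ∃ C, v = 1 + K • C := by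
  have h : ∀ i j, ∃ c, c * K = v i j - (1 : Matrix (Fin 3) (Fin 3) R) i j := by
    intro i j
    rw [← Ideal.mem_span_singleton', ← Ideal.Quotient.eq_zero_iff_mem, map_sub]
    have hij : Ideal.Quotient.mk (Ideal.span {K}) (v i j) = (1 : Matrix (Fin 3) (Fin 3) _) i j := by
      have := congrFun (congrFun hv i) j
      rwa [Matrix.map_apply] at this
    rw [hij]
    simp [Matrix.one_apply]
  choose c hc using h
  refine ⟨Matrix.of fun i j => c i j, ?_⟩
  ext i j
  simp only [Matrix.add_apply, Matrix.smul_apply, Matrix.of_apply, smul_eq_mul]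
  linear_combination -(hc i j)

/-- **Membership in `Γ(K)` from an integral presentation**: `mat g = φ(1 + K • C)` and
`mat g⁻¹ = φ(1 + K • D)` give `g ∈ Γ(K)`. -/
theorem mem_congr_of {g : U21} {K : R} {C D : Matrix (Fin 3) (Fin 3) R}
    (hC : mat g = Mφ φ (1 + K • C)) (hD : mat g⁻¹ = Mφ φ (1 + K • D)) : g ∈ congr φ hφ K := by
  have h1 : Mφ φ (1 + K • C) * Mφ φ (1 + K • D) = 1 := by
    rw [← hC, ← hD, ← mat_mul, mul_inv_cancel, mat_one]
  have h2 : Mφ φ (1 + K • D) * Mφ φ (1 + K • C) = 1 := by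
    rw [← hC, ← hD, ← mat_mul, inv_mul_cancel, mat_one]
  have hg : g ∈ arith φ := mem_arith_of φ (unitOf φ hφ _ _ h1 h2) hC.symm
  refine ⟨⟨g, hg⟩, MonoidHom.mem_ker.mpr ?_, rfl⟩
  apply Units.ext
  rw [coe_red, lift_eq_of_ι_eq φ hφ (g := ⟨g, hg⟩) (u := unitOf φ hφ _ _ h1 h2) (Units.ext hC.symm),
    coe_unitOf, Units.val_one]
  exact map_one_add_smul K C

/-- The matrix of `g ∈ U(2,1)(R)` is the image of its lift. -/
theorem mat_eq_Mφ_lift (g : arith φ) : mat (g : U21) = Mφ φ (lift φ g : Matrix (Fin 3) (Fin 3) R) := by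
  rw [← coe_ι, ι_lift]

/-- **Integral presentation of an element of `Γ(K)`**: `mat g = φ(1 + K • C)` and
`mat g⁻¹ = φ(1 + K • D)` for some `R`-matrices `C, D`. -/
theorem exists_of_mem_congr {g : U21} {K : R} (hg : g ∈ congr φ hφ K) :
    ∃ C D : Matrix (Fin 3) (Fin 3) R, mat g = Mφ φ (1 + K • C) ∧ mat g⁻¹ = Mφ φ (1 + K • D) := by
  obtain ⟨x, hx', rfl⟩ := hg
  have hx : red φ hφ K x = 1 := MonoidHom.mem_ker.mp hx'
  have hx' : red φ hφ K x⁻¹ = 1 := by rw [map_inv, hx, inv_one]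
  have hu : (lift φ x : Matrix (Fin 3) (Fin 3) R).map (Ideal.Quotient.mk (Ideal.span {K})) = 1 := by
    have := congrArg Units.val hx
    rwa [coe_red, Units.val_one] at this
  have hu' : (lift φ x⁻¹ : Matrix (Fin 3) (Fin 3) R).map (Ideal.Quotient.mk (Ideal.span {K})) = 1 := by
    have := congrArg Units.val hx'
    rwa [coe_red, Units.val_one] at this
  obtain ⟨C, hC⟩ := exists_eq_one_add_smul hu
  obtain ⟨D, hD⟩ := exists_eq_one_add_smul hu'
  refine ⟨C, D, ?_, ?_⟩
  · show mat (x : U21) = _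
    rw [mat_eq_Mφ_lift, hC]
  · show mat ((x : U21))⁻¹ = _
    have : ((x : U21))⁻¹ = ((x⁻¹ : arith φ) : U21) := rfl
    rw [this, mat_eq_Mφ_lift, hD]

/-! ### Hecke conjugation and the finite-index clause of A4 -/

/-- `Γ(K) ≤ Γ(M)` when `M ∣ K`. -/
theorem congr_le_congr_of_dvd {K M : R} (h : M ∣ K) : congr φ hφ K ≤ congr φ hφ M := by
  intro g hg
  obtain ⟨C, D, hC, hD⟩ := exists_of_mem_congr φ hφ hg
  obtain ⟨c, rfl⟩ := h
  exact mem_congr_of φ hφ (C := c • C) (D := c • D) (by rw [hC, mul_smul]) (by rw [hD, mul_smul])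

/-- `g⁻¹ Γ g` is monotone in `Γ`. -/
theorem conjSub_mono (g : U21) {Γ₁ Γ₂ : Subgroup U21} (h : Γ₁ ≤ Γ₂) : conjSub g Γ₁ ≤ conjSub g Γ₂ :=
  Subgroup.comap_mono h

/-- The conjugation computation: `g · φ(1 + N²M • X) · g⁻¹ = φ(1 + M • (A X B))` when
`φ A = N • mat g` and `φ B = N • mat g⁻¹`. -/
theorem conj_Mφ_eq (g : U21) (N M : R) (A B : Matrix (Fin 3) (Fin 3) R)
    (hA : Mφ φ A = φ N • mat g) (hB : Mφ φ B = φ N • mat g⁻¹) (X : Matrix (Fin 3) (Fin 3) R) :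
    mat g * Mφ φ (1 + (N ^ 2 * M) • X) * mat g⁻¹ = Mφ φ (1 + M • (A * X * B)) := by
  have hgg : mat g * mat g⁻¹ = 1 := by rw [← mat_mul, mul_inv_cancel, mat_one]
  simp only [map_add, map_one, Mφ_smul, map_mul, map_pow, hA, hB, Matrix.mul_add, Matrix.add_mul,
    Matrix.mul_one, Matrix.mul_smul, Matrix.smul_mul, smul_smul, hgg]
  congr 2
  ring

/-- **Hecke conjugation.**  If `N · g` and `N · g⁻¹` are integral (`φ A = N • mat g`,
`φ B = N • mat g⁻¹`) then `g Γ(N² M) g⁻¹ ≤ Γ(M)`, i.e. `Γ(N² M) ≤ g⁻¹ Γ(M) g`. -/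
theorem congr_le_conjSub (g : U21) (N M : R) (A B : Matrix (Fin 3) (Fin 3) R)
    (hA : Mφ φ A = φ N • mat g) (hB : Mφ φ B = φ N • mat g⁻¹) :
    congr φ hφ (N ^ 2 * M) ≤ conjSub g (congr φ hφ M) := by
  intro δ hδ
  rw [mem_conjSub]
  obtain ⟨C, D, hC, hD⟩ := exists_of_mem_congr φ hφ hδ
  refine mem_congr_of φ hφ (C := A * C * B) (D := A * D * B) ?_ ?_
  · rw [mat_mul, mat_mul, hC, conj_Mφ_eq φ g N M A B hA hB]
  · rw [_root_.mul_inv_rev, _root_.mul_inv_rev, inv_inv, mat_mul, mat_mul, hD, ← Matrix.mul_assoc,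
      conj_Mφ_eq φ g N M A B hA hB]

/-- **The finite-index clause of Lemma W (ROUTE.md A4).**  Let `Γ(M) ≤ Γ′ ≤ U(2,1)(R)` with `R/(N² M)`
finite, and let `g ∈ U(2,1)` be a Hecke element with `N · g`, `N · g⁻¹` integral.  Then
`Γ′ ⊓ g⁻¹ Γ′ g` has finite index in `Γ′`. -/
theorem isFiniteRelIndex_inf_conjSub {Γ' : Subgroup U21} (hΓ : Γ' ≤ arith φ) {M : R}
    (hM : congr φ hφ M ≤ Γ') (g : U21) {N : R} (A B : Matrix (Fin 3) (Fin 3) R)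
    (hA : Mφ φ A = φ N • mat g) (hB : Mφ φ B = φ N • mat g⁻¹)
    [Finite (R ⧸ Ideal.span {N ^ 2 * M})] : (Γ' ⊓ conjSub g Γ').IsFiniteRelIndex Γ' := by
  have h1 : congr φ hφ (N ^ 2 * M) ≤ Γ' ⊓ conjSub g Γ' :=
    le_inf ((congr_le_congr_of_dvd φ hφ (Dvd.intro_left _ rfl)).trans hM)
      ((congr_le_conjSub φ hφ g N M A B hA hB).trans (conjSub_mono g hM))
  haveI : (congr φ hφ (N ^ 2 * M)).IsFiniteRelIndex (arith φ) := isFiniteRelIndex_congr φ hφ _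
  haveI : (congr φ hφ (N ^ 2 * M)).IsFiniteRelIndex Γ' :=
    Subgroup.isFiniteRelIndex_of_le_right (congr φ hφ (N ^ 2 * M)) hΓ
  exact Subgroup.isFiniteRelIndex_of_le_left Γ' h1

/-- **A4, both clauses.**  For `Γ′`-invariant fields `F, G` and a Hecke element `g` as above, the
`(2,0)`-form `(g^*F) ∧ G` is invariant under `Γ′ ⊓ g⁻¹ Γ′ g`, a subgroup of FINITE INDEX in `Γ′`. -/
theorem isInvariantTop_wedgeForm_pull_finiteIndex {Γ' : Subgroup U21} (hΓ : Γ' ≤ arith φ) {M : R}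
    (hM : congr φ hφ M ≤ Γ') (g : U21) {N : R} (A B : Matrix (Fin 3) (Fin 3) R)
    (hA : Mφ φ A = φ N • mat g) (hB : Mφ φ B = φ N • mat g⁻¹)
    [Finite (R ⧸ Ideal.span {N ^ 2 * M})] {F G : Ball → Fin 2 → ℂ}
    (hF : IsInvariant Γ' F) (hG : IsInvariant Γ' G) :
    IsInvariantTop (Γ' ⊓ conjSub g Γ') (wedgeForm (pull g F) G) ∧
      (Γ' ⊓ conjSub g Γ').IsFiniteRelIndex Γ' :=
  ⟨isInvariantTop_wedgeForm_pull hF hG g, isFiniteRelIndex_inf_conjSub φ hφ hΓ hM g A B hA hB⟩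

end lift

/-! ### The integral lattice `U(2,1)(ℤ)` -/

/-- `ℤ/(k)` is finite for `k ≠ 0`. -/
instance finite_int_quotient (k : ℤ) [NeZero k] : Finite (ℤ ⧸ Ideal.span {k}) := by
  haveI : NeZero k.natAbs := ⟨Int.natAbs_ne_zero.mpr (NeZero.ne k)⟩
  exact Finite.of_equiv (ZMod k.natAbs) (Int.quotientSpanEquivZMod k).symm.toEquiv

/-- The finite-index clause for the integral lattice `U(2,1)(ℤ)`: `Γ(M) ≤ Γ′ ≤ U(2,1)(ℤ)`, `M ≠ 0`,
`g` with `N · g`, `N · g⁻¹` integral, `N ≠ 0` ⇒ `Γ′ ⊓ g⁻¹ Γ′ g` has finite index in `Γ′`. -/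
theorem isFiniteRelIndex_inf_conjSub_int {Γ' : Subgroup U21} (hΓ : Γ' ≤ arith (Int.castRingHom ℂ))
    {M : ℤ} (hM0 : M ≠ 0) (hM : congr (Int.castRingHom ℂ) Int.cast_injective M ≤ Γ') (g : U21)
    {N : ℤ} (hN : N ≠ 0) (A B : Matrix (Fin 3) (Fin 3) ℤ)
    (hA : Mφ (Int.castRingHom ℂ) A = (N : ℂ) • mat g)
    (hB : Mφ (Int.castRingHom ℂ) B = (N : ℂ) • mat g⁻¹) :
    (Γ' ⊓ conjSub g Γ').IsFiniteRelIndex Γ' := by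
  haveI : NeZero (N ^ 2 * M) := ⟨mul_ne_zero (pow_ne_zero 2 hN) hM0⟩
  exact isFiniteRelIndex_inf_conjSub (Int.castRingHom ℂ) Int.cast_injective hΓ hM g A B hA hB

end BallCong

end Summit.Ventures.HodgeRepro

end
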